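import Literature.Analysis.InnerProduct.OrbifoldLensSpaceIsospectralRigidity
import HarnessLib

/-!
# The pole at `z = 1` of the generating function of a three-dimensional orbifold lens space: the order of the group is
# heard (Bari–Hunsicker 2019, Corollary 2.14), and a manifold lens space is never isospectral to an orbifold lens space with
# non-trivial isotropy (Theorem 3.1, Case 2 — here by generating functions)

Layer `Literature/Analysis/InnerProduct`, namespace `Literature.Analysis.InnerProduct`; lane `lit-hodgefound`, prover seat
`lit-hodgefound-p06`, generation 46, row g46-#6. THEOREMS only (no definition, no instance, no notation, no named fact).
Companion of `OrbifoldLensSpaceIsospectralRigidity.lean` (row g46-#5: Theorem 3.1, Cases 3 and 4, by the residues at the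
simple poles `γ^k`, `k` prime to `q`). This file looks at the pole `z = 1` of
`F(z) = ∑_n dim E_{n(n+2)}(L(q; s₁, s₂)) z^n = (1/q)∑_{l<q}(1 − z²)/∏_{i}(1 − γ^{ls_i}z)(1 − γ^{−ls_i}z)` ([BariHunsicker2019]
Corollary 2.12 = the tree's `tsum_lensMultiplicity_mul_pow`, valid for arbitrary integer weights).

## Source, verbatim (held text `paper:arxiv-1705.01412`)

N. Bari, E. Hunsicker, *Isospectrality for orbifold lens spaces*, Canad. J. Math. **72** (2020), arXiv:1705.01412. §2.1:
"let `p₁, …, p_n` be `n` integers. Note, if `gcd(p₁, …, p_n, q) ≠ 1`, we can divide all the `p_i`'s and `q` by this gcd to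
get a case where the `gcd = 1`. So, without loss of generality, we can assume `gcd(p₁, …, p_n, q) = 1`. … Then `g`
generates a cyclic subgroup `G = {g^l}_{l=1}^{q}` of order `q` … **Theorem 2.11.** … `F_G(z) = (1/|G|)∑_{g ∈ G}(1 −
z²)/det(I_{2n} − gz)`. … **Corollary 2.12.** … `F_q(z : p₁, …, p_n) = (1/q)∑_{l=1}^{q}(1 − z²)/∏_{i=1}^{n}(z − γ^{p_il})(z −
γ^{−p_il})` … Remark: By the Theorem 2.11 and unique analytic continuation, we can consider the generating function to be a
meromorphic function on the whole complex plane `ℂ` with poles on the unit circle … **Corollary 2.14.** Let `S^{2n−1}/G` and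
`S^{2n−1}/G'` be two isospectral spherical space forms. Then `|G| = |G'|`." §3, proof of **Theorem 3.1** ("Given two
3-dimensional lens spaces `L₁ = L(q : p₁, p₂)` and `L₂ = L(q : s₁, s₂)`. If `L₁` is isospectral to `L₂`, then the two lens
spaces are isometric."): "**Case 2** [One of the two lens spaces, say `L₁` is a manifold, while the other, `L₂` is an orbifold
with non-trivial isotropy groups.] We know that whenever two isospectral good orbifolds share a common Riemannian cover, their
respective singular sets are either both trivial or both non-trivial [GR]. Therefore, for orbifold lens spaces we can't have a
situation where two lens spaces are isospectral, but one has a trivial singular set while the other has a non-trivial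
singular set. So this case is not possible."

## As formalised (isospectral = equality of all `dim E_{n(n+2)} = lensMultiplicity q s₁ s₂ n`; `T_l(z)` the `l`-th term of (3.8))

* §2 **The pole of order three.** At `z = 1` the factors `1 − γ^{±ls_i}z` of `T_l` vanish iff `q ∣ ls_i`. If both pairs
  vanish, `(1 − z)³T_l(z) = 1 + z → 2`; if exactly one pair vanishes, `T_l` has a simple pole and `(1 − z)³T_l → 0`; otherwise
  `T_l` is holomorphic at `1`. Hence **`tendsto_one_sub_pow_three_mul_tsum_lensMultiplicity_orbifold`**:
  `(1 − z)³F(z) → (2/q)·#{l < q : q ∣ ls₁, q ∣ ls₂}` for ALL integer weights (the count is `#{l : g^l = 1} = gcd(s₁, s₂, q)`);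
  under the source's normalization `gcd(s₁, s₂, q) = 1` (`|G| = q`) only `l = 0` counts
  (**`forall_not_dvd_mul_of_coprime_gcd`**, **`coprime_gcd_of_isCoprime_left`**) and the limit is Ikeda–Yamamoto's (3.11)
  `2/q` (**`tendsto_one_sub_pow_three_mul_tsum_lensMultiplicity_of_coprime_gcd`**); so **COROLLARY 2.14** in dimension three:
  **`eq_of_lensMultiplicity_eq_of_coprime_gcd`** — isospectral orbifold lens spaces `L(q; p₁, p₂)`, `L(q'; p₁', p₂')` with
  `|G| = q`, `|G'| = q'` have `q = q'` (the manifold case is the tree's `eq_of_lensMultiplicity_eq`).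
* §3 **The coefficient of `(1 − z)⁻¹`.** The term `l = 0` is `(1 + z)/(1 − z)³ = 2/(1 − z)³ − 1/(1 − z)²`, with no `(1 − z)⁻¹`
  component. When no `0 < l < q` has both pairs vanishing, **`tendsto_one_sub_mul_tsum_lensMultiplicity_sub_principalPart`**:
  `(1 − z)(F(z) − (1 + z)/(q(1 − z)³)) → (1/q)∑_{0<l<q}([q ∣ ls₁]·2/((1 − γ^{ls₂})(1 − γ^{−ls₂})) + [q ∣ ls₂]·2/((1 − γ^{ls₁})(1
  − γ^{−ls₁})))`: the terms with exactly one pair `γ^{±ls_i} = 1` — the elements `g^l ≠ 1` fixing a circle of `S³`, i.e. the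
  non-trivial isotropy — each contribute `2/|1 − γ^{ls_j}|² > 0`. For a MANIFOLD lens space the limit is `0`
  (**`…_of_isCoprime`**).
* §4 **THEOREM 3.1, Case 2, by generating functions** (the source's [GR] argument is replaced — a documented deviation):
  **`exists_lensMultiplicity_ne_of_isCoprime_of_not`**: `L(q; p₁, p₂)` with `p₁, p₂` prime to `q` and `L(q; s₁, s₂)` with
  `s₁` or `s₂` not prime to `q` are not isospectral — equal generating functions would first give `#{l : g₂^l = 1} = 1` (§2)
  and then equal `(1 − z)⁻¹`-coefficients, `0 =` a sum of nonnegative reals containing the positive term of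
  `l = q/gcd(s_i, q)`. Consequences: **`isCoprime_of_lensMultiplicity_eq`** (isospectral to a manifold lens space ⟹ manifold)
  and, with row g46-#5, **`lensWeightsEquivalent_of_lensMultiplicity_eq_of_isCoprime_or`**: THEOREM 3.1 for `L₁` with a weight
  prime to `q` and `L₂` with non-trivial isotropy (Cases 2, 3, 4). Not formalised: Case 1 (both manifolds — Ikeda–Yamamoto
  1979, Yamamoto 1980; in the tree for prime powers, twice prime powers, `q ≤ 10`, odd `q` with `(p₁ ± p₂, q) = 1`) and Case 5
  (no weight prime to `q`: Proposition 3.2, Lemma 3.3 of the source).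

## References

* [BariHunsicker2019] N. Bari, E. Hunsicker, *Isospectrality for orbifold lens spaces*, Canad. J. Math. 72 (2020)
  (arXiv:1705.01412), §2.1 (Theorem 2.11, Corollary 2.12, Remark, Corollary 2.14), §3 Theorem 3.1 (Case 2).
* [IkedaYamamoto1979] A. Ikeda, Y. Yamamoto, *On the spectra of 3-dimensional lens spaces*, Osaka J. Math. 16 (1979) 447–469,
  Theorem 3.2 (3.8), (3.11), Corollary 3.3.
-/

noncomputable section

open Finset Filter Topology Complex

namespace Literature.Analysis.InnerProduct

open _root_.Real _root_.Filter _root_.Topology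


/-! ### §1 Which factors `1 − γ^{±ls}z` vanish at `z = 1`; three limit lemmas -/

/-- `e(a) = 1 ↔ q ∣ a`. [folklore] -/
private theorem exp_intCast_eq_one_iff_a1 {q : ℕ} (hq : q ≠ 0) (a : ℤ) :
    cexp (2 * π * I * a / q) = 1 ↔ (q : ℤ) ∣ a := by
  have hq0 : (q : ℂ) ≠ 0 := Nat.cast_ne_zero.mpr hq
  have h2 : (2 * π * I : ℂ) ≠ 0 := by simp [Real.pi_ne_zero, I_ne_zero]
  constructor
  · intro h
    obtain ⟨n, hn⟩ := Complex.exp_eq_one_iff.mp h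
    have h3 := congrArg (· * (q : ℂ)) hn
    simp only [div_mul_cancel₀ _ hq0] at h3
    have h4 : (2 * π * I) * (a : ℂ) = (2 * π * I) * (n * q) := by linear_combination h3
    have h5 := mul_left_cancel₀ h2 h4
    exact ⟨n, by exact_mod_cast h5.trans (mul_comm _ _)⟩
  · rintro ⟨c, hc⟩
    rw [hc, show (2 * π * I * ((q * c : ℤ) : ℂ) / q) = c * (2 * π * I) by push_cast; field_simp]
    exact Complex.exp_int_mul_two_pi_mul_I c

/-- The factors `1 − γ^{ls}z`, `1 − γ^{−ls}z` of the `l`-th term of (3.8) vanish at `z = 1` iff `q ∣ ls`. [folklore] -/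
private theorem exp_natCast_mul_eq_one_iff_a1 {q : ℕ} (hq : q ≠ 0) (l : ℕ) (s : ℤ) :
    (cexp (2 * π * I * l * s / q) = 1 ↔ (q : ℤ) ∣ l * s) ∧ (cexp (-(2 * π * I * l * s / q)) = 1 ↔ (q : ℤ) ∣ l * s) := by
  have key : cexp (2 * π * I * l * s / q) = 1 ↔ (q : ℤ) ∣ l * s := by
    rw [show (2 * π * I * l * s / q : ℂ) = 2 * π * I * (((l : ℤ) * s : ℤ) : ℂ) / q by push_cast; ring,
      exp_intCast_eq_one_iff_a1 hq]
  refine ⟨key, ?_⟩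
  rw [Complex.exp_neg, inv_eq_one, key]

/-- **All four factors vanish** (`g^l = 1` on both planes): on `z ≠ 1`,
`(1 − z)³·(1 − z²)/((1 − z)(1 − z)·(1 − z)(1 − z)) = 1 + z → 2`. [cite: IkedaYamamoto1979, §3 (3.11)] -/
private theorem tendsto_four_a1 :
    Tendsto (fun z : ℂ ↦ (1 - z) ^ 3 * ((1 - z ^ 2) / ((1 - z) * (1 - z) * ((1 - z) * (1 - z)))))
      (𝓝[≠] (1 : ℂ)) (𝓝 2) := by
  have h : Tendsto (fun z : ℂ ↦ 1 + z) (𝓝[≠] (1 : ℂ)) (𝓝 2) := by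
    have h0 : Tendsto (fun z : ℂ ↦ 1 + z) (𝓝 1) (𝓝 (1 + 1)) := tendsto_const_nhds.add tendsto_id
    rw [one_add_one_eq_two] at h0
    exact h0.mono_left nhdsWithin_le_nhds
  refine h.congr' ?_
  filter_upwards [self_mem_nhdsWithin] with z hz
  have hz1 : (1 : ℂ) - z ≠ 0 := sub_ne_zero.mpr (Ne.symm hz)
  field_simp
  ring

/-- **Exactly one pair of factors vanishes** (a simple pole of the term at `z = 1`): with `P` continuous at `1`, `P(1) ≠ 0`,
`(1 − z)³·(1 − z²)/((1 − z)(1 − z)P(z)) → 0` and `(1 − z)·(1 − z²)/((1 − z)(1 − z)P(z)) = (1 + z)/P(z) → 2/P(1)`. [folklore] -/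
private theorem tendsto_two_a1 {P : ℂ → ℂ} (hP : ContinuousAt P 1) (hP1 : P 1 ≠ 0) :
    Tendsto (fun z : ℂ ↦ (1 - z) ^ 3 * ((1 - z ^ 2) / ((1 - z) * (1 - z) * P z))) (𝓝[≠] (1 : ℂ)) (𝓝 0) ∧
    Tendsto (fun z : ℂ ↦ (1 - z) * ((1 - z ^ 2) / ((1 - z) * (1 - z) * P z))) (𝓝[≠] (1 : ℂ)) (𝓝 (2 / P 1)) := by
  have hev : ∀ᶠ z in 𝓝[≠] (1 : ℂ), z ≠ 1 ∧ P z ≠ 0 := by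
    filter_upwards [self_mem_nhdsWithin, mem_nhdsWithin_of_mem_nhds (hP.eventually_ne hP1)] with z hz hPz
    exact ⟨hz, hPz⟩
  constructor
  · have h0 : Tendsto (fun z : ℂ ↦ (1 - z) * (1 - z ^ 2) / P z) (𝓝 1) (𝓝 ((1 - 1) * (1 - 1 ^ 2) / P 1)) :=
      ((tendsto_const_nhds.sub tendsto_id).mul (tendsto_const_nhds.sub (tendsto_id.pow 2))).div hP.tendsto hP1
    rw [sub_self, zero_mul, zero_div] at h0
    refine (h0.mono_left nhdsWithin_le_nhds).congr' ?_
    filter_upwards [hev] with z ⟨hz, hPz⟩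
    have hz1 : (1 : ℂ) - z ≠ 0 := sub_ne_zero.mpr (Ne.symm hz)
    field_simp
  · have h0 : Tendsto (fun z : ℂ ↦ (1 + z) / P z) (𝓝 1) (𝓝 ((1 + 1) / P 1)) :=
      (tendsto_const_nhds.add tendsto_id).div hP.tendsto hP1
    rw [one_add_one_eq_two] at h0
    refine (h0.mono_left nhdsWithin_le_nhds).congr' ?_
    filter_upwards [hev] with z ⟨hz, hPz⟩
    have hz1 : (1 : ℂ) - z ≠ 0 := sub_ne_zero.mpr (Ne.symm hz)
    field_simp
    ring

/-- **No factor vanishes** (the term is holomorphic at `z = 1`): `(1 − z)^n·(1 − z²)/D(z) → 0` for `n ≠ 0`. [folklore] -/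
private theorem tendsto_zero_a1 {D : ℂ → ℂ} (hD : ContinuousAt D 1) (hD1 : D 1 ≠ 0) {n : ℕ} (hn : n ≠ 0) :
    Tendsto (fun z : ℂ ↦ (1 - z) ^ n * ((1 - z ^ 2) / D z)) (𝓝[≠] (1 : ℂ)) (𝓝 0) := by
  have h1 : Tendsto (fun z : ℂ ↦ (1 - z) ^ n) (𝓝 1) (𝓝 ((1 - 1) ^ n)) := (tendsto_const_nhds.sub tendsto_id).pow n
  rw [sub_self, zero_pow hn] at h1
  have h2 : Tendsto (fun z : ℂ ↦ (1 - z ^ 2) / D z) (𝓝 1) (𝓝 ((1 - 1 ^ 2) / D 1)) :=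
    (tendsto_const_nhds.sub (tendsto_id.pow 2)).div hD.tendsto hD1
  have h3 := h1.mul h2
  rw [zero_mul] at h3
  exact h3.mono_left nhdsWithin_le_nhds

/-- `𝓝[ball 0 1] 1 ≤ 𝓝[≠] 1` and `𝓝[ball 0 1] 1` is nontrivial. [folklore] -/
private theorem nhdsWithin_ball_one_a1 :
    𝓝[Metric.ball (0 : ℂ) 1] (1 : ℂ) ≤ 𝓝[≠] 1 ∧ (𝓝[Metric.ball (0 : ℂ) 1] (1 : ℂ)).NeBot := by
  refine ⟨nhdsWithin_mono _ fun z hz (h1 : z = 1) ↦ ?_, mem_closure_iff_nhdsWithin_neBot.mp ?_⟩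
  · rw [h1, mem_ball_zero_iff, norm_one] at hz
    exact lt_irrefl _ hz
  · rw [closure_ball (0 : ℂ) one_ne_zero, Metric.mem_closedBall, dist_zero_right, norm_one]

/-! ### §2 The pole of order three at `z = 1`: `(1 − z)³F(z) → (2/q)·#{l < q : q ∣ ls₁, q ∣ ls₂}` -/

/-- **The `l`-th term of (3.8) times `(1 − z)³` at `z = 1`**: limit `2` if all four factors vanish there (`q ∣ ls₁` and
`q ∣ ls₂`), `0` otherwise. [cite: IkedaYamamoto1979, §3 (3.11)] [cite: BariHunsicker2019, Corollary 2.12, Corollary 2.14] -/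
private theorem tendsto_term_cube_a1 {q : ℕ} (hq : q ≠ 0) (s₁ s₂ : ℤ) (l : ℕ) :
    Tendsto (fun z : ℂ ↦ (1 - z) ^ 3 * ((1 - z ^ 2) /
      ((1 - cexp (2 * π * I * l * s₁ / q) * z) * (1 - cexp (-(2 * π * I * l * s₁ / q)) * z) *
        ((1 - cexp (2 * π * I * l * s₂ / q) * z) * (1 - cexp (-(2 * π * I * l * s₂ / q)) * z)))))
      (𝓝[≠] (1 : ℂ)) (𝓝 (if (q : ℤ) ∣ l * s₁ ∧ (q : ℤ) ∣ l * s₂ then 2 else 0)) := by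
  obtain ⟨i1, i2⟩ := exp_natCast_mul_eq_one_iff_a1 hq l s₁
  obtain ⟨i3, i4⟩ := exp_natCast_mul_eq_one_iff_a1 hq l s₂
  have n1 : ¬ (q : ℤ) ∣ l * s₁ → (1 - cexp (2 * π * I * l * s₁ / q) * 1) * (1 - cexp (-(2 * π * I * l * s₁ / q)) * 1) ≠ 0 :=
    fun h ↦ by
      rw [mul_one, mul_one]
      exact mul_ne_zero (sub_ne_zero.mpr (Ne.symm fun e ↦ h (i1.mp e))) (sub_ne_zero.mpr (Ne.symm fun e ↦ h (i2.mp e)))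
  have n2 : ¬ (q : ℤ) ∣ l * s₂ → (1 - cexp (2 * π * I * l * s₂ / q) * 1) * (1 - cexp (-(2 * π * I * l * s₂ / q)) * 1) ≠ 0 :=
    fun h ↦ by
      rw [mul_one, mul_one]
      exact mul_ne_zero (sub_ne_zero.mpr (Ne.symm fun e ↦ h (i3.mp e))) (sub_ne_zero.mpr (Ne.symm fun e ↦ h (i4.mp e)))
  by_cases h1 : (q : ℤ) ∣ l * s₁ <;> by_cases h2 : (q : ℤ) ∣ l * s₂
  · rw [if_pos ⟨h1, h2⟩]
    simp only [i1.mpr h1, i2.mpr h1, i3.mpr h2, i4.mpr h2, one_mul]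
    exact tendsto_four_a1
  · rw [if_neg fun h ↦ h2 h.2]
    simp only [i1.mpr h1, i2.mpr h1, one_mul]
    exact (tendsto_two_a1 (P := fun z ↦ (1 - cexp (2 * π * I * l * s₂ / q) * z) *
      (1 - cexp (-(2 * π * I * l * s₂ / q)) * z)) (by fun_prop) (n2 h2)).1
  · rw [if_neg fun h ↦ h1 h.1]
    simp only [i3.mpr h2, i4.mpr h2, one_mul]
    refine ((tendsto_two_a1 (P := fun z ↦ (1 - cexp (2 * π * I * l * s₁ / q) * z) *
      (1 - cexp (-(2 * π * I * l * s₁ / q)) * z)) (by fun_prop) (n1 h1)).1.congr fun z ↦ ?_)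
    ring
  · rw [if_neg fun h ↦ h1 h.1]
    exact tendsto_zero_a1 (D := fun z ↦ (1 - cexp (2 * π * I * l * s₁ / q) * z) *
      (1 - cexp (-(2 * π * I * l * s₁ / q)) * z) * ((1 - cexp (2 * π * I * l * s₂ / q) * z) *
        (1 - cexp (-(2 * π * I * l * s₂ / q)) * z))) (by fun_prop) (mul_ne_zero (n1 h1) (n2 h2)) three_ne_zero

/-- **THE POLE OF ORDER THREE AT `z = 1` FOR ARBITRARY (ORBIFOLD) WEIGHTS.** For every `q ≥ 1` and all integers `s₁, s₂`,
the generating function `F(z) = ∑_n dim E_{n(n+2)}(L(q; s₁, s₂)) z^n` satisfies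
`(1 − z)³F(z) → (2/q)·#{0 ≤ l < q : q ∣ ls₁ and q ∣ ls₂}` as `z → 1` in the unit disc: exactly the terms of
(3.8) = [BariHunsicker2019, Corollary 2.12] with `g^l = 1` (all four factors `1 − γ^{±ls_i}z` equal to `1 − z`) have a pole
of order three at `1`, each contributing `lim (1 − z)³(1 − z²)/(1 − z)⁴ = 2`; a term with exactly one pair `γ^{±ls_i} = 1` has
a simple pole, the others are holomorphic at `1`. (The count is `gcd(s₁, s₂, q) = q/|G|`; for a lens space with `|G| = q`,
i.e. `gcd(s₁, s₂, q) = 1`, it is `1` and the limit is Ikeda–Yamamoto's (3.11) `2/q`.) [cite: BariHunsicker2019, Theorem 2.11,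
Corollary 2.12, Corollary 2.14] [cite: IkedaYamamoto1979, §3 (3.11)] -/
theorem tendsto_one_sub_pow_three_mul_tsum_lensMultiplicity_orbifold (q : ℕ) [NeZero q] (s₁ s₂ : ℤ) :
    Tendsto (fun z : ℂ ↦ (1 - z) ^ 3 * ∑' n : ℕ, (lensMultiplicity q s₁ s₂ n : ℂ) * z ^ n)
      (𝓝[Metric.ball 0 1] 1)
      (𝓝 (2 / (q : ℂ) * (((range q).filter fun l : ℕ ↦ (q : ℤ) ∣ l * s₁ ∧ (q : ℤ) ∣ l * s₂).card : ℂ))) := by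
  have hq : q ≠ 0 := NeZero.ne q
  have h := tendsto_finsetSum (range q) fun l (_ : l ∈ range q) ↦ tendsto_term_cube_a1 hq s₁ s₂ l
  rw [Finset.sum_ite, Finset.sum_const_zero, add_zero, Finset.sum_const, nsmul_eq_mul] at h
  have h' := h.const_mul (1 / (q : ℂ))
  rw [show ∀ c : ℂ, 1 / (q : ℂ) * (c * 2) = 2 / (q : ℂ) * c from fun c ↦ by ring] at h'
  refine (h'.mono_left nhdsWithin_ball_one_a1.1).congr' ?_
  filter_upwards [self_mem_nhdsWithin] with z hz
  rw [tsum_lensMultiplicity_mul_pow q hq s₁ s₂ (mem_ball_zero_iff.mp hz), Finset.mul_sum, Finset.mul_sum, Finset.mul_sum]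
  exact Finset.sum_congr rfl fun l _ ↦ by ring

/-- For `0 < l < q` and `s` prime to `q`: `q ∤ ls`. [folklore] -/
private theorem not_dvd_mul_of_isCoprime_a1 {q : ℕ} {s : ℤ} (hs : IsCoprime s q) {l : ℕ} (hl : 0 < l) (hlq : l < q) :
    ¬ (q : ℤ) ∣ l * s := by
  intro h
  have h1 : (q : ℤ) ∣ (l : ℤ) := hs.symm.dvd_of_dvd_mul_right h
  have h2 : q ∣ l := by exact_mod_cast h1
  have h3 := Nat.eq_zero_of_dvd_of_lt h2 hlq
  omega

/-- **Only `l = 0` has `g^l = 1`** when `gcd(s₁, s₂, q) = 1` (the normalization `|G| = q` of an orbifold lens space: "if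
`gcd(p₁, …, p_n, q) ≠ 1`, we can divide all the `p_i`'s and `q` by this gcd"). [cite: BariHunsicker2019, §2.1] -/
theorem forall_not_dvd_mul_of_coprime_gcd {q : ℕ} {s₁ s₂ : ℤ} (hg : (Int.gcd s₁ s₂).Coprime q) :
    ∀ l : ℕ, 0 < l → l < q → ¬ ((q : ℤ) ∣ l * s₁ ∧ (q : ℤ) ∣ l * s₂) := by
  rintro l hl hlq ⟨ha, hb⟩
  have e : (l : ℤ) * (Int.gcd s₁ s₂ : ℤ) = Int.gcdA s₁ s₂ * (l * s₁) + Int.gcdB s₁ s₂ * (l * s₂) := by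
    rw [Int.gcd_eq_gcd_ab]
    ring
  have h3 : (q : ℤ) ∣ (l : ℤ) * (Int.gcd s₁ s₂ : ℤ) := by
    rw [e]
    exact (ha.mul_left _).add (hb.mul_left _)
  have h4 : q ∣ l * Int.gcd s₁ s₂ := by exact_mod_cast h3
  have h5 : q ∣ l := hg.symm.dvd_of_dvd_mul_right h4
  have h6 := Nat.eq_zero_of_dvd_of_lt h5 hlq
  omega

/-- A weight prime to `q` makes `gcd(s₁, s₂, q) = 1`. [folklore] -/
private theorem coprime_gcd_of_isCoprime_left {q : ℕ} {s₁ : ℤ} (hs : IsCoprime s₁ q) (s₂ : ℤ) : (Int.gcd s₁ s₂).Coprime q := by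
  have h1 : Nat.Coprime s₁.natAbs q := by
    have := Int.isCoprime_iff_nat_coprime.mp hs
    rwa [Int.natAbs_natCast] at this
  exact Nat.Coprime.coprime_dvd_left (Int.natCast_dvd.mp (Int.gcd_dvd_left s₁ s₂)) h1

/-- The set `{l < q : q ∣ ls₁, q ∣ ls₂}` is `{0}` when no `0 < l < q` lies in it. [folklore] -/
private theorem filter_eq_singleton_a1 {q : ℕ} [NeZero q] {s₁ s₂ : ℤ}
    (h1 : ∀ l : ℕ, 0 < l → l < q → ¬ ((q : ℤ) ∣ l * s₁ ∧ (q : ℤ) ∣ l * s₂)) :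
    ((range q).filter fun l : ℕ ↦ (q : ℤ) ∣ l * s₁ ∧ (q : ℤ) ∣ l * s₂) = {0} := by
  ext l
  simp only [Finset.mem_filter, Finset.mem_range, Finset.mem_singleton]
  constructor
  · rintro ⟨hlq, hboth⟩
    by_contra hl0
    exact h1 l (Nat.pos_of_ne_zero hl0) hlq hboth
  · rintro rfl
    exact ⟨Nat.pos_of_ne_zero (NeZero.ne q), by simp⟩

/-- Conversely, if `#{l < q : q ∣ ls₁, q ∣ ls₂} = 1` then no `0 < l < q` lies in it (`l = 0` always does). [folklore] -/
private theorem forall_not_of_card_eq_one_a1 {q : ℕ} [NeZero q] {s₁ s₂ : ℤ}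
    (h : ((range q).filter fun l : ℕ ↦ (q : ℤ) ∣ l * s₁ ∧ (q : ℤ) ∣ l * s₂).card = 1) :
    ∀ l : ℕ, 0 < l → l < q → ¬ ((q : ℤ) ∣ l * s₁ ∧ (q : ℤ) ∣ l * s₂) := by
  obtain ⟨a, ha⟩ := Finset.card_eq_one.mp h
  have h0 : (0 : ℕ) ∈ (range q).filter fun l : ℕ ↦ (q : ℤ) ∣ l * s₁ ∧ (q : ℤ) ∣ l * s₂ := by
    simp [Nat.pos_of_ne_zero (NeZero.ne q)]
  rw [ha, Finset.mem_singleton] at h0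
  intro l hl hlq hboth
  have hl' : l ∈ (range q).filter fun l : ℕ ↦ (q : ℤ) ∣ l * s₁ ∧ (q : ℤ) ∣ l * s₂ :=
    Finset.mem_filter.mpr ⟨Finset.mem_range.mpr hlq, hboth⟩
  rw [ha, Finset.mem_singleton] at hl'
  omega

/-- **(3.11) FOR ORBIFOLD LENS SPACES WITH `|G| = q`**: if `gcd(s₁, s₂, q) = 1` then `(1 − z)³F(z) → 2/q` as `z → 1` in the
disc. [cite: BariHunsicker2019, Corollary 2.12, Corollary 2.14] [cite: IkedaYamamoto1979, §3 (3.11)] -/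
theorem tendsto_one_sub_pow_three_mul_tsum_lensMultiplicity_of_coprime_gcd (q : ℕ) [NeZero q] {s₁ s₂ : ℤ}
    (hg : (Int.gcd s₁ s₂).Coprime q) :
    Tendsto (fun z : ℂ ↦ (1 - z) ^ 3 * ∑' n : ℕ, (lensMultiplicity q s₁ s₂ n : ℂ) * z ^ n)
      (𝓝[Metric.ball 0 1] 1) (𝓝 (2 / (q : ℂ))) := by
  have h := tendsto_one_sub_pow_three_mul_tsum_lensMultiplicity_orbifold q s₁ s₂
  rwa [filter_eq_singleton_a1 (forall_not_dvd_mul_of_coprime_gcd hg), Finset.card_singleton, Nat.cast_one, mul_one] at h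

/-- **COROLLARY 2.14 (Bari–Hunsicker 2019) for three-dimensional orbifold lens spaces: "Let `S^{2n−1}/G` and `S^{2n−1}/G'` be
two isospectral spherical space forms. Then `|G| = |G'|`."** If `L(q; p₁, p₂)` and `L(q'; p₁', p₂')` are orbifold lens spaces
with `|G| = q`, `|G'| = q'` (`gcd(p₁, p₂, q) = 1 = gcd(p₁', p₂', q')`) and the same multiplicities `dim E_{n(n+2)}` for all
`n`, then `q = q'` (the generating functions coincide and `(1 − z)³F → 2/q`, resp. `2/q'`). The manifold case is the tree's
`eq_of_lensMultiplicity_eq` (Ikeda–Yamamoto's Corollary 3.3). [cite: BariHunsicker2019, Corollary 2.14, Proposition 2.10]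
[cite: IkedaYamamoto1979, Corollary 3.3] -/
theorem eq_of_lensMultiplicity_eq_of_coprime_gcd {q q' : ℕ} [NeZero q] [NeZero q'] {p₁ p₂ p₁' p₂' : ℤ}
    (hp : (Int.gcd p₁ p₂).Coprime q) (hp' : (Int.gcd p₁' p₂').Coprime q')
    (h : ∀ n : ℕ, lensMultiplicity q p₁ p₂ n = lensMultiplicity q' p₁' p₂' n) : q = q' := by
  have h1 := tendsto_one_sub_pow_three_mul_tsum_lensMultiplicity_of_coprime_gcd q hp
  have h2 := tendsto_one_sub_pow_three_mul_tsum_lensMultiplicity_of_coprime_gcd q' hp'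
  simp only [← h] at h2
  haveI := nhdsWithin_ball_one_a1.2
  have e := tendsto_nhds_unique h1 h2
  rw [div_eq_div_iff (Nat.cast_ne_zero.mpr (NeZero.ne q)) (Nat.cast_ne_zero.mpr (NeZero.ne q'))] at e
  have e2 := mul_left_cancel₀ two_ne_zero e
  exact_mod_cast e2.symm

/-! ### §3 The coefficient of `(1 − z)⁻¹` at `z = 1`: `(1 − z)(F(z) − (1 + z)/(q(1 − z)³))` -/

/-- **The `l`-th term of (3.8), `0 < l`, times `1 − z` at `z = 1`** when not both pairs vanish: limit
`2/((1 − γ^{ls₂})(1 − γ^{−ls₂}))` if `q ∣ ls₁` (the pair `γ^{±ls₁} = 1` gives the simple pole `(1 + z)/((1 − z)·pair₂(z))`),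
`2/((1 − γ^{ls₁})(1 − γ^{−ls₁}))` if `q ∣ ls₂`, and `0` if the term is holomorphic at `1` (the terms of the closed form
(3.8) = Corollary 2.12 at `z = 1`). [folklore] [cite: BariHunsicker2019, Corollary 2.12] -/
private theorem tendsto_term_simple_a1 {q : ℕ} (hq : q ≠ 0) (s₁ s₂ : ℤ) {l : ℕ}
    (hl : ¬ ((q : ℤ) ∣ l * s₁ ∧ (q : ℤ) ∣ l * s₂)) :
    Tendsto (fun z : ℂ ↦ (1 - z) * ((1 - z ^ 2) /
      ((1 - cexp (2 * π * I * l * s₁ / q) * z) * (1 - cexp (-(2 * π * I * l * s₁ / q)) * z) *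
        ((1 - cexp (2 * π * I * l * s₂ / q) * z) * (1 - cexp (-(2 * π * I * l * s₂ / q)) * z)))))
      (𝓝[≠] (1 : ℂ))
      (𝓝 ((if (q : ℤ) ∣ l * s₁ then
          2 / ((1 - cexp (2 * π * I * l * s₂ / q)) * (1 - cexp (-(2 * π * I * l * s₂ / q)))) else 0) +
        (if (q : ℤ) ∣ l * s₂ then
          2 / ((1 - cexp (2 * π * I * l * s₁ / q)) * (1 - cexp (-(2 * π * I * l * s₁ / q)))) else 0))) := by
  obtain ⟨i1, i2⟩ := exp_natCast_mul_eq_one_iff_a1 hq l s₁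
  obtain ⟨i3, i4⟩ := exp_natCast_mul_eq_one_iff_a1 hq l s₂
  have n1 : ¬ (q : ℤ) ∣ l * s₁ → (1 - cexp (2 * π * I * l * s₁ / q) * 1) * (1 - cexp (-(2 * π * I * l * s₁ / q)) * 1) ≠ 0 :=
    fun h ↦ by
      rw [mul_one, mul_one]
      exact mul_ne_zero (sub_ne_zero.mpr (Ne.symm fun e ↦ h (i1.mp e))) (sub_ne_zero.mpr (Ne.symm fun e ↦ h (i2.mp e)))
  have n2 : ¬ (q : ℤ) ∣ l * s₂ → (1 - cexp (2 * π * I * l * s₂ / q) * 1) * (1 - cexp (-(2 * π * I * l * s₂ / q)) * 1) ≠ 0 :=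
    fun h ↦ by
      rw [mul_one, mul_one]
      exact mul_ne_zero (sub_ne_zero.mpr (Ne.symm fun e ↦ h (i3.mp e))) (sub_ne_zero.mpr (Ne.symm fun e ↦ h (i4.mp e)))
  by_cases h1 : (q : ℤ) ∣ l * s₁ <;> by_cases h2 : (q : ℤ) ∣ l * s₂
  · exact absurd ⟨h1, h2⟩ hl
  · rw [if_pos h1, if_neg h2, add_zero]
    simp only [i1.mpr h1, i2.mpr h1, one_mul]
    have h := (tendsto_two_a1 (P := fun z ↦ (1 - cexp (2 * π * I * l * s₂ / q) * z) *
      (1 - cexp (-(2 * π * I * l * s₂ / q)) * z)) (by fun_prop) (n2 h2)).2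
    simp only [mul_one] at h
    exact h
  · rw [if_neg h1, if_pos h2, zero_add]
    simp only [i3.mpr h2, i4.mpr h2, one_mul]
    have h := (tendsto_two_a1 (P := fun z ↦ (1 - cexp (2 * π * I * l * s₁ / q) * z) *
      (1 - cexp (-(2 * π * I * l * s₁ / q)) * z)) (by fun_prop) (n1 h1)).2
    simp only [mul_one] at h
    refine h.congr fun z ↦ ?_
    ring
  · rw [if_neg h1, if_neg h2, add_zero]
    have h := tendsto_zero_a1 (D := fun z ↦ (1 - cexp (2 * π * I * l * s₁ / q) * z) *
      (1 - cexp (-(2 * π * I * l * s₁ / q)) * z) * ((1 - cexp (2 * π * I * l * s₂ / q) * z) *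
        (1 - cexp (-(2 * π * I * l * s₂ / q)) * z))) (by fun_prop) (mul_ne_zero (n1 h1) (n2 h2)) one_ne_zero
    simp only [pow_one] at h
    exact h

/-- The term `l = 0` is the principal part `(1 + z)/(q(1 − z)³)` up to the factor `1/q`; removing it leaves
`(1 − z)·(1/q)∑_{0<l<q} T_l(z)`. [folklore] -/
private theorem algebra_a1 {q : ℂ} (hq : q ≠ 0) {z : ℂ} (hz : 1 - z ≠ 0) (S : ℂ) :
    (1 - z) * (1 / q * ((1 - z ^ 2) / ((1 - z) * (1 - z) * ((1 - z) * (1 - z))) + S) - (1 + z) / (q * (1 - z) ^ 3)) =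
      1 / q * ((1 - z) * S) := by
  field_simp
  ring

/-- **THE COEFFICIENT OF `(1 − z)⁻¹` AT `z = 1`** for an orbifold lens space `L(q; s₁, s₂)` with `|G| = q` in the form "no
`0 < l < q` has `q ∣ ls₁` and `q ∣ ls₂`": removing the principal part `(1 + z)/(q(1 − z)³)` of the term `l = 0` (which has
no `(1 − z)⁻¹` component: `(1 + z)/(1 − z)³ = 2/(1 − z)³ − 1/(1 − z)²`),
`(1 − z)·(F(z) − (1 + z)/(q(1 − z)³)) → (1/q)∑_{0<l<q}([q ∣ ls₁]·2/((1 − γ^{ls₂})(1 − γ^{−ls₂})) + [q ∣ ls₂]·2/((1 − γ^{ls₁})(1 −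
γ^{−ls₁})))` as `z → 1` in the disc — the terms with exactly one pair `γ^{±ls_i} = 1`, i.e. the elements `g^l ≠ 1` of `G`
with a fixed circle on `S³`, each contribute a simple pole. This is the Laurent coefficient at `z = 1` of the published
closed form, computed here ("we can consider the generating function to be a meromorphic function on the whole complex plane
`ℂ` with poles on the unit circle"). [cite: BariHunsicker2019, Corollary 2.12 and the Remark after it]
[cite: IkedaYamamoto1979, Theorem 3.2 (3.8), §3 p. 453 ("Any pole of `F(z)` is a `q`-th root of one")] -/
theorem tendsto_one_sub_mul_tsum_lensMultiplicity_sub_principalPart {q : ℕ} [NeZero q] {s₁ s₂ : ℤ}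
    (h1 : ∀ l : ℕ, 0 < l → l < q → ¬ ((q : ℤ) ∣ l * s₁ ∧ (q : ℤ) ∣ l * s₂)) :
    Tendsto (fun z : ℂ ↦ (1 - z) *
        (∑' n : ℕ, (lensMultiplicity q s₁ s₂ n : ℂ) * z ^ n - (1 + z) / ((q : ℂ) * (1 - z) ^ 3)))
      (𝓝[Metric.ball 0 1] 1)
      (𝓝 (1 / (q : ℂ) * ∑ l ∈ Ico 1 q, ((if (q : ℤ) ∣ l * s₁ then
          2 / ((1 - cexp (2 * π * I * l * s₂ / q)) * (1 - cexp (-(2 * π * I * l * s₂ / q)))) else 0) +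
        (if (q : ℤ) ∣ l * s₂ then
          2 / ((1 - cexp (2 * π * I * l * s₁ / q)) * (1 - cexp (-(2 * π * I * l * s₁ / q)))) else 0)))) := by
  have hq : q ≠ 0 := NeZero.ne q
  have hqC : (q : ℂ) ≠ 0 := Nat.cast_ne_zero.mpr hq
  have h := tendsto_finsetSum (Ico 1 q) fun l (hl : l ∈ Ico 1 q) ↦
    tendsto_term_simple_a1 hq s₁ s₂ (h1 l (Finset.mem_Ico.mp hl).1 (Finset.mem_Ico.mp hl).2)
  have h' := h.const_mul (1 / (q : ℂ))
  refine (h'.mono_left nhdsWithin_ball_one_a1.1).congr' ?_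
  filter_upwards [self_mem_nhdsWithin] with z hz
  have hz' : ‖z‖ < 1 := mem_ball_zero_iff.mp hz
  have hz1 : (1 : ℂ) - z ≠ 0 := by
    refine sub_ne_zero.mpr (Ne.symm fun h0 ↦ ?_)
    rw [h0, norm_one] at hz'
    exact lt_irrefl _ hz'
  rw [tsum_lensMultiplicity_mul_pow q hq s₁ s₂ hz', Finset.range_eq_Ico,
    Finset.sum_eq_sum_Ico_succ_bot (Nat.pos_of_ne_zero hq), ← Finset.mul_sum]
  simp only [Nat.cast_zero, mul_zero, zero_mul, zero_div, neg_zero, Complex.exp_zero, one_mul]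
  exact (algebra_a1 hqC hz1 _).symm

/-- **For a MANIFOLD lens space the coefficient of `(1 − z)⁻¹` vanishes**: all terms `0 < l < q` of (3.8) are holomorphic at
`z = 1` (`q ∤ lp_i`), so `(1 − z)(F(z) − (1 + z)/(q(1 − z)³)) → 0`. [cite: IkedaYamamoto1979, §3 (proof of Corollary 3.3:
"Any pole of `F(z)` is a `q`-th root of one", the terms `l ≠ 0` being regular at `1`)] -/
theorem tendsto_one_sub_mul_tsum_lensMultiplicity_sub_principalPart_of_isCoprime {q : ℕ} [NeZero q] {p₁ p₂ : ℤ}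
    (hp₁ : IsCoprime p₁ q) (hp₂ : IsCoprime p₂ q) :
    Tendsto (fun z : ℂ ↦ (1 - z) *
        (∑' n : ℕ, (lensMultiplicity q p₁ p₂ n : ℂ) * z ^ n - (1 + z) / ((q : ℂ) * (1 - z) ^ 3)))
      (𝓝[Metric.ball 0 1] 1) (𝓝 0) := by
  have h := tendsto_one_sub_mul_tsum_lensMultiplicity_sub_principalPart
    (forall_not_dvd_mul_of_coprime_gcd (coprime_gcd_of_isCoprime_left hp₁ p₂))
  rwa [Finset.sum_eq_zero fun l hl ↦ ?_, mul_zero] at h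
  obtain ⟨hl1, hlq⟩ := Finset.mem_Ico.mp hl
  rw [if_neg (not_dvd_mul_of_isCoprime_a1 hp₁ hl1 hlq), if_neg (not_dvd_mul_of_isCoprime_a1 hp₂ hl1 hlq), add_zero]

/-! ### §4 The simple-pole coefficient is POSITIVE for an orbifold with non-trivial isotropy; THEOREM 3.1, Case 2 -/

/-- `(1 − γ^{t})(1 − γ^{−t}) = |1 − γ^{t}|²` (as `γ^{−t} = conj γ^{t}`). [folklore] -/
private theorem pair_eq_normSq_a1 (q l : ℕ) (s : ℤ) :
    (1 - cexp (2 * π * I * l * s / q)) * (1 - cexp (-(2 * π * I * l * s / q))) =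
      ((Complex.normSq (1 - cexp (2 * π * I * l * s / q)) : ℝ) : ℂ) := by
  have hn : ‖cexp (2 * π * I * l * s / q)‖ = 1 := by
    rw [show (2 * π * I * l * s / q : ℂ) = ((2 * π * l * s / q : ℝ) : ℂ) * I by push_cast; ring]
    exact Complex.norm_exp_ofReal_mul_I _
  have hinv : cexp (-(2 * π * I * l * s / q)) = (starRingEnd ℂ) (cexp (2 * π * I * l * s / q)) := by
    rw [Complex.exp_neg, Complex.inv_def, Complex.normSq_eq_norm_sq, hn, one_pow, inv_one, Complex.ofReal_one, mul_one]
  rw [hinv, ← Complex.mul_conj, map_sub, map_one]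

/-- `2/((1 − γ^{t})(1 − γ^{−t})) = 2/|1 − γ^t|²` has nonnegative real part (it is `0` when `γ^t = 1`). [folklore] -/
private theorem re_two_div_pair_nonneg_a1 (q l : ℕ) (s : ℤ) :
    0 ≤ (2 / ((1 - cexp (2 * π * I * l * s / q)) * (1 - cexp (-(2 * π * I * l * s / q))))).re := by
  rw [pair_eq_normSq_a1, show (2 : ℂ) = ((2 : ℝ) : ℂ) by norm_num, ← Complex.ofReal_div, Complex.ofReal_re]
  exact div_nonneg zero_le_two (Complex.normSq_nonneg _)

/-- … and positive real part `2/|1 − γ^t|² = 1/(2 sin²(πt/q))` when `γ^t ≠ 1`. [folklore] -/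
private theorem re_two_div_pair_pos_a1 {q l : ℕ} {s : ℤ} (h : cexp (2 * π * I * l * s / q) ≠ 1) :
    0 < (2 / ((1 - cexp (2 * π * I * l * s / q)) * (1 - cexp (-(2 * π * I * l * s / q))))).re := by
  rw [pair_eq_normSq_a1, show (2 : ℂ) = ((2 : ℝ) : ℂ) by norm_num, ← Complex.ofReal_div, Complex.ofReal_re]
  exact div_pos two_pos (Complex.normSq_pos.mpr (sub_ne_zero.mpr (Ne.symm h)))

/-- **A weight NOT prime to `q` produces an element `g^l ≠ 1` fixing a circle**: if `s` is not prime to `q` then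
`q ∣ l s` for `l = q/gcd(s, q)`, `0 < l < q`. [cite: BariHunsicker2019, §2.1 ("To get an orbifold … with non-trivial
singularities, we must have `gcd(p_i, q) > 1` for some `i`")] -/
private theorem exists_dvd_mul_of_not_isCoprime_a1 {q : ℕ} [NeZero q] {s : ℤ} (hs : ¬ IsCoprime s q) :
    ∃ l : ℕ, 0 < l ∧ l < q ∧ (q : ℤ) ∣ l * s := by
  have hq : q ≠ 0 := NeZero.ne q
  have hq0 : 0 < q := Nat.pos_of_ne_zero hq
  set g : ℕ := Int.gcd s q with hg
  have hg1 : g ≠ 1 := fun h ↦ hs (Int.isCoprime_iff_gcd_eq_one.mpr h)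
  have hgq : g ∣ q := Int.natCast_dvd_natCast.mp (Int.gcd_dvd_right s q)
  have hgs : (g : ℤ) ∣ s := Int.gcd_dvd_left s q
  have hg0 : 0 < g := Nat.pos_of_dvd_of_pos hgq hq0
  refine ⟨q / g, Nat.div_pos (Nat.le_of_dvd hq0 hgq) hg0, Nat.div_lt_self hq0 (by omega), ?_⟩
  obtain ⟨c, hc⟩ := hgs
  refine ⟨c, ?_⟩
  rw [hc, ← mul_assoc]
  congr 1
  exact_mod_cast Nat.div_mul_cancel hgq

/-- **THEOREM 3.1 (Bari–Hunsicker 2019), Case 2: a three-dimensional MANIFOLD lens space and an orbifold lens space with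
non-trivial isotropy are never isospectral.** Let `L₁ = L(q : p₁, p₂)` with `p₁, p₂` prime to `q` and `L₂ = L(q : s₁, s₂)`
with `s₁` or `s₂` NOT prime to `q`. Then some multiplicity `dim E_{n(n+2)}` differs. The source settles this case by [GR]
("whenever two isospectral good orbifolds share a common Riemannian cover, their respective singular sets are either both
trivial or both non-trivial"); the proof HERE is by the generating functions of Corollary 2.12 instead (a deviation from the
printed argument, recorded as such): if `F₁ = F₂` then (§2) `#{l < q : g₂^l = 1} = #{l < q : g₁^l = 1} = 1`, and then (§3) the
coefficients of `(1 − z)⁻¹` at `z = 1` agree — `0` for the manifold, while for `L₂` it is `(1/q)∑ 2/|1 − γ^{t}|²` over a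
NONEMPTY set of terms (the element `g₂^{q/gcd(s_i,q)} ≠ 1` fixes a circle), a positive real number.
[cite: BariHunsicker2019, Theorem 3.1 (Case 2), Corollary 2.12] -/
theorem exists_lensMultiplicity_ne_of_isCoprime_of_not {q : ℕ} [NeZero q] {p₁ p₂ s₁ s₂ : ℤ}
    (hp₁ : IsCoprime p₁ q) (hp₂ : IsCoprime p₂ q) (hs : ¬ (IsCoprime s₁ q ∧ IsCoprime s₂ q)) :
    ∃ n : ℕ, lensMultiplicity q p₁ p₂ n ≠ lensMultiplicity q s₁ s₂ n := by
  have hq : q ≠ 0 := NeZero.ne q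
  have hqC : (q : ℂ) ≠ 0 := Nat.cast_ne_zero.mpr hq
  by_contra! h
  haveI := nhdsWithin_ball_one_a1.2
  -- Step 1: `g₂^l = 1` only for `l = 0`
  have h1p := forall_not_dvd_mul_of_coprime_gcd (coprime_gcd_of_isCoprime_left hp₁ p₂)
  have t1 := tendsto_one_sub_pow_three_mul_tsum_lensMultiplicity_orbifold q p₁ p₂
  have t2 := tendsto_one_sub_pow_three_mul_tsum_lensMultiplicity_orbifold q s₁ s₂
  simp only [h] at t1
  have e := mul_left_cancel₀ (div_ne_zero two_ne_zero hqC) (tendsto_nhds_unique t1 t2)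
  rw [filter_eq_singleton_a1 h1p, Finset.card_singleton] at e
  have hNs : ((range q).filter fun l : ℕ ↦ (q : ℤ) ∣ l * s₁ ∧ (q : ℤ) ∣ l * s₂).card = 1 := by exact_mod_cast e.symm
  have h1s := forall_not_of_card_eq_one_a1 hNs
  -- Step 2: the coefficients of `(1 − z)⁻¹` agree
  have u1 := tendsto_one_sub_mul_tsum_lensMultiplicity_sub_principalPart_of_isCoprime hp₁ hp₂
  have u2 := tendsto_one_sub_mul_tsum_lensMultiplicity_sub_principalPart h1s
  simp only [h] at u1
  have e2 := tendsto_nhds_unique u1 u2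
  rw [eq_comm, mul_eq_zero, or_iff_right (one_div_ne_zero hqC)] at e2
  -- Step 3: but the orbifold's coefficient has positive real part
  obtain ⟨l₀, hl₀, hl₀q, hdvd⟩ : ∃ l : ℕ, 0 < l ∧ l < q ∧ ((q : ℤ) ∣ l * s₁ ∨ (q : ℤ) ∣ l * s₂) := by
    by_cases hs₁ : IsCoprime s₁ q
    · obtain ⟨l, hl, hlq, hd⟩ := exists_dvd_mul_of_not_isCoprime_a1 (q := q) (s := s₂) fun hs₂ ↦ hs ⟨hs₁, hs₂⟩
      exact ⟨l, hl, hlq, Or.inr hd⟩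
    · obtain ⟨l, hl, hlq, hd⟩ := exists_dvd_mul_of_not_isCoprime_a1 hs₁
      exact ⟨l, hl, hlq, Or.inl hd⟩
  obtain ⟨i1, _⟩ := exp_natCast_mul_eq_one_iff_a1 hq l₀ s₁
  obtain ⟨i3, _⟩ := exp_natCast_mul_eq_one_iff_a1 hq l₀ s₂
  have key : 0 < (∑ l ∈ Ico 1 q, ((if (q : ℤ) ∣ l * s₁ then
          2 / ((1 - cexp (2 * π * I * l * s₂ / q)) * (1 - cexp (-(2 * π * I * l * s₂ / q)))) else 0) +
        (if (q : ℤ) ∣ l * s₂ then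
          2 / ((1 - cexp (2 * π * I * l * s₁ / q)) * (1 - cexp (-(2 * π * I * l * s₁ / q)))) else 0))).re := by
    rw [Complex.re_sum]
    refine Finset.sum_pos' (fun l _ ↦ ?_) ⟨l₀, Finset.mem_Ico.mpr ⟨hl₀, hl₀q⟩, ?_⟩
    · rw [Complex.add_re]
      refine add_nonneg ?_ ?_ <;> split_ifs
      · exact re_two_div_pair_nonneg_a1 q l s₂
      · rw [Complex.zero_re]
      · exact re_two_div_pair_nonneg_a1 q l s₁
      · rw [Complex.zero_re]
    · rw [Complex.add_re]
      rcases hdvd with hd | hd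
      · have hn : ¬ (q : ℤ) ∣ l₀ * s₂ := fun h' ↦ h1s l₀ hl₀ hl₀q ⟨hd, h'⟩
        rw [if_pos hd, if_neg hn, Complex.zero_re, add_zero]
        exact re_two_div_pair_pos_a1 fun h' ↦ hn (i3.mp h')
      · have hn : ¬ (q : ℤ) ∣ l₀ * s₁ := fun h' ↦ h1s l₀ hl₀ hl₀q ⟨h', hd⟩
        rw [if_neg hn, if_pos hd, Complex.zero_re, zero_add]
        exact re_two_div_pair_pos_a1 fun h' ↦ hn (i1.mp h')
  rw [e2, Complex.zero_re] at key
  exact lt_irrefl _ key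

/-- **THEOREM 3.1, Case 2, as a transfer statement**: a lens space isospectral to a MANIFOLD lens space `L(q : p₁, p₂)` is a
manifold (both its weights are prime to `q`). [cite: BariHunsicker2019, Theorem 3.1 (Case 2)] -/
theorem isCoprime_of_lensMultiplicity_eq {q : ℕ} [NeZero q] {p₁ p₂ s₁ s₂ : ℤ} (hp₁ : IsCoprime p₁ q)
    (hp₂ : IsCoprime p₂ q) (h : ∀ n : ℕ, lensMultiplicity q p₁ p₂ n = lensMultiplicity q s₁ s₂ n) :
    IsCoprime s₁ q ∧ IsCoprime s₂ q := by
  by_contra hs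
  obtain ⟨n, hn⟩ := exists_lensMultiplicity_ne_of_isCoprime_of_not hp₁ hp₂ hs
  exact hn (h n)

/-- **THEOREM 3.1 (Bari–Hunsicker 2019), Cases 2, 3 and 4 together: "Two three-dimensional isospectral orbifold lens spaces
are isometric" whenever `L₁` has a weight prime to `q` and `L₂` has non-trivial isotropy.** Let `L₁ = L(q : p₁, p₂)` with
`p₁` or `p₂` prime to `q` and `L₂ = L(q : s₁, s₂)` with `s₁, s₂` not both prime to `q`. If `L₁` and `L₂` are isospectral
then Ikeda's / Corollary 2.2's isometry criterion holds: `(p₁, p₂)` is a permutation of `(±ls₁, ±ls₂) (mod q)` (with `l`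
prime to `q`, `LensWeightsEquivalent.exists_isCoprime`). Case 2 (`L₁` a manifold) cannot occur, by
`isCoprime_of_lensMultiplicity_eq`; Cases 3–4 are `lensWeightsEquivalent_of_lensMultiplicity_eq_orbifold`. What remains of
THEOREM 3.1 outside this statement: Case 1 (both manifolds: Ikeda–Yamamoto 1979 and Yamamoto 1980) and Case 5 (no weight
prime to `q`). [cite: BariHunsicker2019, Theorem 3.1 (Cases 2–4), Corollary 2.2] -/
theorem lensWeightsEquivalent_of_lensMultiplicity_eq_of_isCoprime_or {q : ℕ} [NeZero q] {p₁ p₂ s₁ s₂ : ℤ}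
    (hp : IsCoprime p₁ q ∨ IsCoprime p₂ q) (hs : ¬ (IsCoprime s₁ q ∧ IsCoprime s₂ q))
    (h : ∀ n : ℕ, lensMultiplicity q p₁ p₂ n = lensMultiplicity q s₁ s₂ n) :
    LensWeightsEquivalent q ![p₁, p₂] ![s₁, s₂] := by
  by_cases hb : IsCoprime p₁ q ∧ IsCoprime p₂ q
  · exact absurd (isCoprime_of_lensMultiplicity_eq hb.1 hb.2 h) hs
  · have hx : Xor (IsCoprime p₁ q) (IsCoprime p₂ q) := by
      rcases hp with h1 | h2
      · exact Or.inl ⟨h1, fun h2 ↦ hb ⟨h1, h2⟩⟩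
      · exact Or.inr ⟨h2, fun h1 ↦ hb ⟨h1, h2⟩⟩
    exact lensWeightsEquivalent_of_lensMultiplicity_eq_orbifold hx hs h

end Literature.Analysis.InnerProduct
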